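import Literature.NumberTheory.LFunctions.WeilFirstPrimeCells
import Literature.NumberTheory.LFunctions.WeilPositivityCertificate
import HarnessLib

/-!
# Sharp rational constants for the first-prime certificate: `1/(2π)`, `log π`, `ψ(1/4)`

Topic: `Literature/NumberTheory/LFunctions`. The Stage-C (`a₀ = (log 3)/2`) first-prime
certificate has a margin of about `5·10⁻⁸`, so every constant entering it must be certified to
`10⁻¹⁰` or better; the six-to-eight-digit constants of the archimedean certificate
(`invTwoPiHi`, `logPiHi`, `psiQuarterLo` of `WeilPositivityCertificate.lean` /
`WeilPositivityMinorant.lean`) are replaced here by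

* `invTwoPiLo20 ≤ 1/(2π) ≤ invTwoPiHi20` from `Real.pi_gt_d20`, `Real.pi_lt_d20`;
* `log π ≤ logPiHi20`: `log π ≤ log piHi20 = log 3 + log(1 + y)`, `y = piHi20/3 − 1`, with `log 3`
  from the verified engine (`FI.logTable 3`) and `log(1+y)` by `Real.abs_log_sub_add_sum_range_le`;
* `psiQuarterLo20 ≤ ψ(1/4)` by the Stirling lower bound at `x = 1/4 + 256` and the recurrence
  (`Real.log_sub_le_re_digamma`, `re_digamma_add_nat`), with `log(1025/4) = 8 log 2 + log(1 + 1/1024)`.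

Everything here is proved; no named facts.

## References

* H. Alzer, *On some inequalities for the gamma and psi functions*, Math. Comp. 66 (1997), (2.2)
  (the Stirling-type bound for `ψ`, in the tree as `Real.log_sub_le_re_digamma`).
-/

noncomputable section

open Real

namespace Literature.NumberTheory.LFunctions

open Literature.Analysis.ValidatedNumerics.Numerics
open Literature.Analysis.SpecialFunctions

/-! ## `1/(2π)` to twenty digits -/

/-- `3.14159265358979323846 < π` as a rational. [folklore] -/
def piLo20 : ℚ := 314159265358979323846 / 100000000000000000000

/-- `π < 3.14159265358979323847` as a rational. [folklore] -/
def piHi20 : ℚ := 314159265358979323847 / 100000000000000000000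

/-- `piLo20 < π`. [folklore] -/
theorem piLo20_lt : ((piLo20 : ℚ) : ℝ) < π := by
  have h := Real.pi_gt_d20
  have e : ((piLo20 : ℚ) : ℝ) = 3.14159265358979323846 := by unfold piLo20; push_cast; norm_num
  rw [e]; exact h

/-- `π < piHi20`. [folklore] -/
theorem lt_piHi20 : π < ((piHi20 : ℚ) : ℝ) := by
  have h := Real.pi_lt_d20
  have e : ((piHi20 : ℚ) : ℝ) = 3.14159265358979323847 := by unfold piHi20; push_cast; norm_num
  rw [e]; exact h

/-- An upper bound for `1/(2π)`, twenty digits. [folklore] -/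
def invTwoPiHi20 : ℚ := 1 / (2 * piLo20)

/-- A lower bound for `1/(2π)`, twenty digits. [folklore] -/
def invTwoPiLo20 : ℚ := 1 / (2 * piHi20)

/-- `1/(2π) ≤ invTwoPiHi20`. [folklore] -/
theorem invTwoPiHi20_ge : 1 / (2 * π) ≤ ((invTwoPiHi20 : ℚ) : ℝ) := by
  have h := piLo20_lt
  have h0 : (0 : ℝ) < (piLo20 : ℚ) := by unfold piLo20; push_cast; norm_num
  unfold invTwoPiHi20
  push_cast
  exact one_div_le_one_div_of_le (by positivity) (by linarith)

/-- `invTwoPiLo20 ≤ 1/(2π)`. [folklore] -/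
theorem invTwoPiLo20_le : ((invTwoPiLo20 : ℚ) : ℝ) ≤ 1 / (2 * π) := by
  have h := lt_piHi20
  unfold invTwoPiLo20
  push_cast
  exact one_div_le_one_div_of_le (by positivity) (by linarith)

/-- `0 ≤ invTwoPiHi20`. [folklore] -/
theorem invTwoPiHi20_nonneg : (0 : ℝ) ≤ ((invTwoPiHi20 : ℚ) : ℝ) :=
  le_trans (by positivity) invTwoPiHi20_ge

/-- `invTwoPiLo20 ≤ invTwoPiHi20`. [folklore] -/
theorem invTwoPiLo20_le_invTwoPiHi20 : ((invTwoPiLo20 : ℚ) : ℝ) ≤ ((invTwoPiHi20 : ℚ) : ℝ) :=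
  invTwoPiLo20_le.trans invTwoPiHi20_ge

/-- `invTwoPiHi20 ≤ invTwoPiHi` (the six-digit constant of the archimedean certificate), so that
`nuScale = invTwoPiHi20/invTwoPiHi ≤ 1`. [folklore] -/
theorem invTwoPiHi20_le_invTwoPiHi : invTwoPiHi20 ≤ invTwoPiHi := by
  unfold invTwoPiHi20 invTwoPiHi piLo20 piLo; norm_num

/-- The ratio of the two upper bounds of `1/(2π)`: scaling the moment table by it turns the
archimedean block matrix `Sym − invTwoPiHi · Ĝ(ν)` into `Sym − invTwoPiHi20 · Ĝ(ν)`. [folklore] -/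
def nuScale : ℚ := invTwoPiHi20 / invTwoPiHi

/-- `invTwoPiHi · nuScale = invTwoPiHi20`. [folklore] -/
theorem invTwoPiHi_mul_nuScale : invTwoPiHi * nuScale = invTwoPiHi20 := by
  unfold nuScale
  have h : invTwoPiHi ≠ 0 := by unfold invTwoPiHi piLo; norm_num
  field_simp

/-! ## `log π` -/

/-- The engine accepts the logarithm table up to `3`. [folklore] -/
theorem logTableOK_three : FI.logTableOK 3 = true := by
  decide +kernel

/-- `log 3` as a fixed-point interval of the engine. [folklore] -/
def logThreeFI : FI := (FI.logTable 3).getD 3 (FI.ofInt 0)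

/-- `log 3 ∈ logThreeFI`. [folklore] -/
theorem mem_logThreeFI : FI.mem (Real.log 3) logThreeFI := by
  have h := FI.mem_logTable logTableOK_three (le_refl 3)
  simpa [logThreeFI] using h

/-- Rational upper end of the `log 3` interval. [folklore] -/
def logThreeHiQ : ℚ := logThreeFI.hiQ

/-- `log 3 ≤ logThreeHiQ`. [folklore] -/
theorem logThree_le : Real.log 3 ≤ ((logThreeHiQ : ℚ) : ℝ) := FI.le_hiQ mem_logThreeFI

/-- `y = piHi20/3 − 1` (so that `log piHi20 = log 3 + log(1 + y)`). [folklore] -/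
def piOverThreeSubOne : ℚ := piHi20 / 3 - 1

/-- Upper bound of `log(1 + y)` from eight terms of the series and the geometric remainder:
`−Σ_{i<8} (−y)^{i+1}/(i+1) + y⁹/(1 − y)`. [folklore] -/
def logOnePlusHiQ (y : ℚ) (n : ℕ) : ℚ :=
  -(∑ i ∈ Finset.range n, (-y) ^ (i + 1) / (i + 1)) + y ^ (n + 1) / (1 - y)

/-- `log(1 + y) ≤ logOnePlusHiQ y n` for rational `0 ≤ y < 1`. [folklore] -/
theorem log_one_add_le_logOnePlusHiQ {y : ℚ} (hy0 : 0 ≤ y) (hy1 : y < 1) (n : ℕ) :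
    Real.log (1 + (y : ℝ)) ≤ ((logOnePlusHiQ y n : ℚ) : ℝ) := by
  have habs : |(-(y : ℝ))| < 1 := by
    rw [abs_neg, abs_of_nonneg (by exact_mod_cast hy0)]; exact_mod_cast hy1
  have h := Real.abs_log_sub_add_sum_range_le habs n
  rw [abs_le] at h
  have h2 := h.2
  rw [abs_neg, abs_of_nonneg (by exact_mod_cast hy0 : (0 : ℝ) ≤ y), sub_neg_eq_add] at h2
  unfold logOnePlusHiQ
  push_cast
  linarith

/-- An upper bound for `log π`, about twelve digits. [folklore] -/
def logPiHi20 : ℚ := logThreeHiQ + logOnePlusHiQ piOverThreeSubOne 8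

/-- `log π ≤ logPiHi20`. [folklore] -/
theorem logPiHi20_ge : Real.log π ≤ ((logPiHi20 : ℚ) : ℝ) := by
  have hy0 : (0 : ℚ) ≤ piOverThreeSubOne := by unfold piOverThreeSubOne piHi20; norm_num
  have hy1 : piOverThreeSubOne < (1 : ℚ) := by unfold piOverThreeSubOne piHi20; norm_num
  have h1 : Real.log π ≤ Real.log ((piHi20 : ℚ) : ℝ) :=
    Real.log_le_log Real.pi_pos lt_piHi20.le
  have h2 : Real.log ((piHi20 : ℚ) : ℝ) = Real.log 3 + Real.log (1 + ((piOverThreeSubOne : ℚ) : ℝ)) := by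
    rw [← Real.log_mul (by norm_num) (by unfold piOverThreeSubOne piHi20; norm_num)]
    congr 1
    unfold piOverThreeSubOne
    push_cast
    ring
  have h3 := log_one_add_le_logOnePlusHiQ hy0 hy1 8
  have h4 := logThree_le
  unfold logPiHi20
  push_cast
  linarith

/-! ## `ψ(1/4)` -/

/-- `log(1 + 1/1024) ≥ 1/1024 − 1/(2·1024²) + 1/(3·1024³) − (1/1024)⁴/(1023/1024)`
(`Real.abs_log_sub_add_sum_range_le`). [folklore] -/
theorem log_one_add_inv_1024_ge :
    (1 / 1024 - 1 / (2 * 1024 ^ 2) + 1 / (3 * 1024 ^ 3) - (1 / 1024) ^ 4 / (1023 / 1024) : ℝ) ≤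
      Real.log (1 + 1 / 1024) := by
  have h := Real.abs_log_sub_add_sum_range_le (x := -(1 / 1024 : ℝ))
    (by rw [abs_neg, abs_of_pos (by norm_num)]; norm_num) 3
  rw [abs_le] at h
  have h1 := h.1
  simp only [Finset.sum_range_succ, Finset.sum_range_zero, sub_neg_eq_add] at h1
  norm_num [abs_of_pos] at h1 ⊢
  linarith

/-- The rational lower bound for `log(1025/4) = 8 log 2 + log(1 + 1/1024)`. [folklore] -/
def log1025Div4LoQ : ℚ :=
  8 * logTwoLoQ + (1 / 1024 - 1 / (2 * 1024 ^ 2) + 1 / (3 * 1024 ^ 3) - (1 / 1024) ^ 4 / (1023 / 1024))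

/-- `log1025Div4LoQ ≤ log(1025/4)`. [folklore] -/
theorem log1025Div4LoQ_le : ((log1025Div4LoQ : ℚ) : ℝ) ≤ Real.log (1025 / 4) := by
  have h2 := logTwo_mem_Q.1
  have h3 := log_one_add_inv_1024_ge
  have e : Real.log (1025 / 4) = 8 * Real.log 2 + Real.log (1 + 1 / 1024) := by
    rw [show (1025 / 4 : ℝ) = 2 ^ 8 * (1 + 1 / 1024) by norm_num, Real.log_mul (by norm_num)
      (by norm_num), Real.log_pow]
    push_cast
    ring
  rw [e]
  unfold log1025Div4LoQ
  push_cast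
  linarith

/-- The rational number `Σ_{j<256} 1/(1/4 + j)`. [folklore] -/
def harmonicQuarter256 : ℚ := ∑ j ∈ Finset.range 256, (1 : ℚ) / (1 / 4 + j)

/-- **`ψ(1/4)` from below, about twelve digits:**
`log(1025/4)_lo − 1/(2x) − 1/(12x²) − Σ_{j<256} 1/(1/4+j)`, `x = 1025/4`, rounded down to `2⁻¹⁰⁰ ℤ`. [folklore] -/
def psiQuarterLo20 : ℚ :=
  ratRd 100 (log1025Div4LoQ - 1 / (2 * (1025 / 4)) - 1 / (12 * (1025 / 4) ^ 2) - harmonicQuarter256)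

/-- **`psiQuarterLo20 ≤ ψ(1/4)`** (Stirling lower bound `log x − 1/(2x) − 1/(12x²) ≤ ψ(x)` of the tree,
`Real.log_sub_le_re_digamma`, at `x = 1/4 + 256`, and the recurrence). [folklore] -/
theorem psiQuarterLo20_le : ((psiQuarterLo20 : ℚ) : ℝ) ≤ (Complex.digamma (1 / 4)).re := by
  have hq : (0 : ℝ) < 1 / 4 := by norm_num
  have hrec := re_digamma_add_nat hq 256
  have hst := Real.log_sub_le_re_digamma (x := 1 / 4 + 256) (by norm_num)
  have hcast : (((1 / 4 : ℝ) : ℂ) + (256 : ℕ)) = (((1 / 4 + 256 : ℝ)) : ℂ) := by push_cast; ring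
  rw [hcast] at hrec
  have e1025 : (1 / 4 + 256 : ℝ) = 1025 / 4 := by norm_num
  rw [e1025] at hst hrec
  rw [hrec] at hst
  have e14 : ((1 / 4 : ℝ) : ℂ) = 1 / 4 := by push_cast; ring
  rw [e14] at hst
  have hS : ∑ j ∈ Finset.range 256, (1 : ℝ) / (1 / 4 + j) = ((harmonicQuarter256 : ℚ) : ℝ) := by
    unfold harmonicQuarter256; push_cast; rfl
  rw [hS] at hst
  have hlog := log1025Div4LoQ_le
  have hrd := (Rat.cast_le (K := ℝ)).2 (ratRd_le 100
    (log1025Div4LoQ - 1 / (2 * (1025 / 4)) - 1 / (12 * (1025 / 4) ^ 2) - harmonicQuarter256))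
  have epsi : ((psiQuarterLo20 : ℚ) : ℝ) = ((ratRd 100
      (log1025Div4LoQ - 1 / (2 * (1025 / 4)) - 1 / (12 * (1025 / 4) ^ 2) - harmonicQuarter256) : ℚ) : ℝ) := by
    rfl
  rw [epsi]
  refine hrd.trans ?_
  push_cast
  linarith

/-- `psiQuarterLo20 ≤ Re ψ(1/4 + i·0/2)` in the notation of the vertical series. [folklore] -/
theorem psiQuarterLo20_le' : ((psiQuarterLo20 : ℚ) : ℝ) ≤ reDigammaQuarter 0 := by
  rw [reDigammaQuarter_zero]; exact psiQuarterLo20_le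

end Literature.NumberTheory.LFunctions
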